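import Literature.NumberTheory.EllipticCurves.ComplexMultiplicationShaProofs
import Literature.NumberTheory.EllipticCurves.ComplexMultiplicationTwistIsogenyProofs
import Mathlib.NumberTheory.LSeries.Injectivity
import HarnessLib

/-!
# Deuring's `L(E_K/K, s) = L(E/ℚ, s)²` from Artin formalism, the CM twist isogeny and Knapp 11.67

Sibling proof file (D-0014 append protocol; everything here is proved, no definitions) of
`Literature.NumberTheory.EllipticCurves.ComplexMultiplicationShaProofs` for its named fact
`Literature.NumberTheory.EllipticCurves.Deuring_LFunction_baseChange_cmField` — Deuring's theorem (Silverman, *Advanced Topics*,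
Ch. II, Thm. 10.5 (a) and (b), PDF p. 171 of the held copy) in the Grössencharacter-free form it
takes for an elliptic curve `E/ℚ` with CM by the maximal order `𝓞_K` and `K` its CM field:
`(W.baseChange K).LFunction = W.LFunction * W.LFunction`, i.e. `L(E_K/K, s) = L(E/ℚ, s)²` as formal
Dirichlet series. The printed proof (loc. cit., p. 172 and Exercises 2.30–2.32, p. 179) goes
through the Grössencharacter `ψ_{E/K}` (Thm. 9.2: main theorem of complex multiplication + class
field theory + Néron–Ogg–Shafarevich), which neither Mathlib nor the tree has. This file records
the **first level of the decomposition**: the character-free identity is *not an independent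
leaf* of the bsd.S28 graphs — it follows, sorry-free, from three named facts the tree already
carries for the Burungale–Flach descent (`ComplexMultiplicationBurungaleFlachDescentProofs.lean`):

1. **Artin formalism** `L(E_K/K, s) = L(E/ℚ, s) · L(E^{(d_K)}/ℚ, s)` for the quadratic field `K`
   of discriminant `d_K` (`WeierstrassCurve.LSeries_baseChange_quadratic`; Ireland–Rosen,
   Prop. 20.5.4(b));
2. **the CM twist isogeny** `E ∼_ℚ E^{(d_K)}` for `E` with CM by `𝓞_K`
   (`Literature.NumberTheory.EllipticCurves.isIsogenous_quadraticTwist_cmFieldDiscr`; Milne 1972, Thm. 3, through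
   Burungale–Flach 2024, proof of Cor. 2; proved in the tree for `j = 0, 1728, 8000` and reduced
   to six explicit curves otherwise, `isIsogenous_quadraticTwist_cmFieldDiscr_of_models`);
3. **Knapp's Theorem 11.67**, isogenous curves over `ℚ` have the same `L`-function
   (`Literature.NumberTheory.EllipticCurves.LFunction_eq_of_isIsogenous`),

because then `L(E_K/K, s) = L(E, s) L(E^{(d_K)}, s) = L(E, s)²` on `Re s > 3/2`, and two integer
Dirichlet series converging somewhere and agreeing for all large real `s` have the same
coefficients (Mathlib's `LSeries.eq_of_LSeries_eventually_eq`; absolute convergence of `L(E, s)`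
on `Re s > 3/2` is the tree's proved `WeierstrassCurve.LSeriesSummable_of_lt_re_holds`). This is
also how the identity is usually derived in print from the theory of CM newforms
(`f_E ⊗ χ_K = f_E`); Silverman's route through `ψ_{E/K}` is decomposed prime by prime in the
sibling file `ComplexMultiplicationDeuringLocal.lean`.

## Main statements

* `WeierstrassCurve.LFunction_eq_mul_of_LSeries_eq_mul` (**proved**, general): three Weierstrass
  curves over number fields with `L(W₂, x) = L(W₀, x) · L(W₁, x)` for all large real `x` have
  `W₂.LFunction = W₀.LFunction * W₁.LFunction` (injectivity of the Dirichlet transform).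
* `Deuring_LFunction_baseChange_cmField_of_artinFormalism` (**proved**): facts 1–3 imply
  `Deuring_LFunction_baseChange_cmField`.
* `Deuring_LFunction_baseChange_cmField_of_artinFormalism_of_models` (**proved**): the same with
  fact 2 replaced by its six-curve residue `isIsogenous_quadraticTwist_cmFieldDiscr_models`.

## References

* J. H. Silverman, *Advanced Topics in the Arithmetic of Elliptic Curves*, GTM 151 (1994),
  Ch. II §10, Thm. 10.5 and its proof, Exercises 2.30–2.32 (PDF pp. 168–172, 179).
  [SilvermanATAEC1994]
* K. Ireland, M. Rosen, *A Classical Introduction to Modern Number Theory*, 2nd ed. (1990),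
  Ch. 20 §5, Prop. 20.5.4(b). [IrelandRosen1990]
* J. S. Milne, *On the arithmetic of abelian varieties*, Invent. Math. 17 (1972), Thm. 3;
  A. Burungale, M. Flach, Camb. J. Math. 12 (2024), proof of Cor. 2. [Milne1972ArithmeticAV]
  [BurungaleFlach2024]
* A. W. Knapp, *Elliptic Curves* (1992), Thm. 11.67. [Knapp1993]
-/

noncomputable section

open scoped Classical LSeries.notation

open Complex NumberField Filter

namespace WeierstrassCurve

/-! ### Injectivity of the Dirichlet transform on formal `L`-functions of Weierstrass curves -/

/-- **`L(W₂, x) = L(W₀, x) L(W₁, x)` for large real `x` forces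
`W₂.LFunction = W₀.LFunction * W₁.LFunction`.** The three `L`-series converge absolutely for
`Re s > 3/2` (`LSeriesSummable_of_lt_re_holds`), the product of two of them is the `L`-series of
the Dirichlet convolution (`Literature.NumberTheory.EllipticCurves.LSeries_intCoe_mul`), and a Dirichlet series with finite
abscissa of convergence is determined by its values at large real arguments (Mathlib
`LSeries.eq_of_LSeries_eventually_eq`). [folklore] -/
theorem LFunction_eq_mul_of_LSeries_eq_mul {K₀ K₁ K₂ : Type*} [Field K₀] [NumberField K₀]
    [Field K₁] [NumberField K₁] [Field K₂] [NumberField K₂] {W₀ : WeierstrassCurve K₀}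
    {W₁ : WeierstrassCurve K₁} {W₂ : WeierstrassCurve K₂} (x₀ : ℝ)
    (h : ∀ x : ℝ, x₀ < x → W₂.LSeries x = W₀.LSeries x * W₁.LSeries x) :
    W₂.LFunction = W₀.LFunction * W₁.LFunction := by
  -- the two coefficient sequences, as functions `ℕ → ℂ`
  set f : ℕ → ℂ := fun n ↦ (W₂.LFunction n : ℂ) with hf_def
  set g : ℕ → ℂ := fun n ↦ ((W₀.LFunction * W₁.LFunction) n : ℂ) with hg_def
  have hf : LSeries.abscissaOfAbsConv f < ⊤ := W₂.abscissaOfAbsConv_LFunction_lt_top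
  -- `g` is the Dirichlet convolution of two sequences converging absolutely at `s = 2`
  have hg2 : LSeriesSummable g 2 := by
    have h0 : LSeriesSummable ↗(W₀.LFunction : ArithmeticFunction ℂ) 2 := by
      simp only [ArithmeticFunction.intCoe_apply]
      exact W₀.LSeriesSummable_of_lt_re_holds (s := 2) (by norm_num)
    have h1 : LSeriesSummable ↗(W₁.LFunction : ArithmeticFunction ℂ) 2 := by
      simp only [ArithmeticFunction.intCoe_apply]
      exact W₁.LSeriesSummable_of_lt_re_holds (s := 2) (by norm_num)
    have h01 := ArithmeticFunction.LSeriesSummable_mul h0 h1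
    rw [← ArithmeticFunction.intCoe_mul] at h01
    simp only [ArithmeticFunction.intCoe_apply] at h01
    exact h01
  have hg : LSeries.abscissaOfAbsConv g < ⊤ :=
    hg2.abscissaOfAbsConv_le.trans_lt (EReal.coe_lt_top _)
  -- the two `L`-series agree for `x > max x₀ (3/2)`
  have hfg : (fun x : ℝ ↦ LSeries f x) =ᶠ[atTop] fun x ↦ LSeries g x := by
    rw [EventuallyEq, eventually_atTop]
    refine ⟨max x₀ (3 / 2) + 1, fun x hx ↦ ?_⟩
    have hx₀ : x₀ < x := by linarith [le_max_left x₀ (3 / 2)]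
    have hx' : (3 / 2 : ℝ) < (x : ℂ).re := by
      simp only [ofReal_re]; linarith [le_max_right x₀ (3 / 2)]
    have key := h x hx₀
    simp only [WeierstrassCurve.LSeries] at key
    rw [← Literature.NumberTheory.EllipticCurves.LSeries_intCoe_mul (W₀.LSeriesSummable_of_lt_re_holds hx')
      (W₁.LSeriesSummable_of_lt_re_holds hx')] at key
    exact key
  -- hence the coefficients agree
  ext n
  rcases eq_or_ne n 0 with rfl | hn
  · simp
  · have := LSeries.eq_of_LSeries_eventually_eq hf hg hfg hn
    simp only [hf_def, hg_def] at this
    exact_mod_cast this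

end WeierstrassCurve

namespace Literature.NumberTheory.EllipticCurves

open WeierstrassCurve

/-! ### Deuring's character-free identity from Artin formalism -/

/-- **Deuring's `L(E_K/K, s) = L(E/ℚ, s)²` from Artin formalism, the CM twist isogeny and
Knapp 11.67.** For `E/ℚ` with `j(E) ∈ maximalCMJInvariants` and `K ≅ ℚ(√d_K)` its CM field
(`IsCMFieldOfJ K j(E)`, so `[K : ℚ] = 2` and `disc K = d_K q²`): by Artin formalism (`hBCL`,
Ireland–Rosen Prop. 20.5.4(b)) `L(E_K/K, s) = L(E, s) · L(E^{(disc K)}, s)` for `Re s > 3/2`; by the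
CM twist isogeny (`hTW`, through `isIsogenous_quadraticTwist_discr_of_isCMFieldOfJ`)
`E ∼_ℚ E^{(disc K)}`, so `L(E^{(disc K)}, s) = L(E, s)` by Knapp 11.67 (`hKn`); hence
`L(E_K/K, s) = L(E, s)²` for `Re s > 3/2`, and the formal Dirichlet series agree
(`LFunction_eq_mul_of_LSeries_eq_mul`). This is Deuring's theorem, Silverman *Advanced Topics*
II.10.5 (a)+(b), in the combined form vendored as `Deuring_LFunction_baseChange_cmField`.
[cite: SilvermanATAEC1994, Ch. II Thm. 10.5 (a), (b) (PDF p. 171)]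
[cite: IrelandRosen1990, Ch. 20 §5, Prop. 20.5.4(b)] -/
theorem Deuring_LFunction_baseChange_cmField_of_artinFormalism
    (hBCL : LSeries_baseChange_quadratic) (hTW : isIsogenous_quadraticTwist_cmFieldDiscr)
    (hKn : LFunction_eq_of_isIsogenous) : Deuring_LFunction_baseChange_cmField := by
  intro W _ hj K _ _ hK
  have hd : ((NumberField.discr K : ℤ) : ℚ) ≠ 0 := by exact_mod_cast NumberField.discr_ne_zero K
  haveI := W.isElliptic_quadraticTwist hd
  have hiso : IsIsogenous W (W.quadraticTwist (NumberField.discr K : ℚ)) :=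
    isIsogenous_quadraticTwist_discr_of_isCMFieldOfJ hTW W hj K hK
  have hL : (W.quadraticTwist (NumberField.discr K : ℚ)).LSeries = W.LSeries :=
    LSeries_eq_of_LFunction_eq (hKn W _ hiso).symm
  refine LFunction_eq_mul_of_LSeries_eq_mul (3 / 2) fun x hx ↦ ?_
  have hx' : (3 / 2 : ℝ) < (x : ℂ).re := by simpa using hx
  rw [hBCL W K hK.1 x hx', hL]

/-- The same with the CM twist isogeny replaced by its six-curve residue
`isIsogenous_quadraticTwist_cmFieldDiscr_models` (the cases `j = 0, 1728, 8000` being proved in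
`ComplexMultiplicationTwistIsogenyProofs.lean`): Deuring's identity for all nine maximal-order
CM `j`-invariants follows from Artin formalism, Knapp 11.67 and the `ℚ`-isogenies
`E_D ∼ E_D^{(D)}` of the six curves `E_D`, `D ∈ {-7, -11, -19, -43, -67, -163}`.
[cite: SilvermanATAEC1994, Ch. II Thm. 10.5 (a), (b) (PDF p. 171)] -/
theorem Deuring_LFunction_baseChange_cmField_of_artinFormalism_of_models
    (hBCL : LSeries_baseChange_quadratic) (hTW₆ : isIsogenous_quadraticTwist_cmFieldDiscr_models)
    (hKn : LFunction_eq_of_isIsogenous) : Deuring_LFunction_baseChange_cmField :=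
  Deuring_LFunction_baseChange_cmField_of_artinFormalism hBCL
    (isIsogenous_quadraticTwist_cmFieldDiscr_of_models hTW₆) hKn

end Literature.NumberTheory.EllipticCurves

end
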